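import Mathlib
import HarnessLib
import Summits.Ventures.LatticeQCDFlow.Exactness.LatentReversibleProposals

/-!
# LatticeQCDFlow / Exactness — ONE BLOCK AT A TIME: a move of ONE block of latent coordinates that is reversible for that block's base law, with the
# other block frozen, is reversible for the product base — so blockwise latent moves (blockwise Crank–Nicolson, blockwise involutions, block
# redraws) read through the flow and accepted with the plain importance ratio are exact, block by block

HONEST FRAMING: exact (Metropolis-corrected) sampling algorithms for lattice gauge theory;
figures of merit are autocorrelation/cost numbers at stated couplings and volumes; no
continuum-physics claim.

Venture `LatticeQCDFlow` (cell pub-lqcd), topic `Exactness`, FANOUT row 30 (lean-1 GEN-43, part II: MOVES IN FLOW SPACE; generalises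
`LatentBlockRefreshReversible`, whose block REDRAW is the case `S₁(z₁, ·) = γ₁`).  NEW WORK of the cell over Mathlib's product measures
(`lintegral_prod_symm`, measurable sections); no definition is introduced, nothing is cited as a fact.  Printed counterpart NAMED ONLY:
"Metropolis-within-Gibbs" ∕ blockwise updates are reversible block by block (Tierney 1994 §2.4); the tree's `FibreLift` treats block updates
of the FIELD with a joint density.

## Setting and results [all ours]

Latent space `Z₁ × Z₂`, PRODUCT base `γ = γ₁ ⊗ γ₂`; a move `S₁` of block 1 reversible for `γ₁`; THE BLOCK MOVE, def-free: ANY kernel `S` on `Z₁ × Z₂`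
with `S((z₁, z₂), B) = S₁(z₁, {z₁′ : (z₁′, z₂) ∈ B})` — move block 1 by `S₁`, keep block 2 (hypothesis `hS`).

* **`blockMove_setLIntegral`**: `∫_A S(z, B) dγ = ∫ (∫_{A_{z₂}} S₁(z₁, B_{z₂}) γ₁(dz₁)) γ₂(dz₂)` with the sections `A_{z₂} = {z₁ : (z₁, z₂) ∈ A}`.
* **`blockMove_isReversible`**: `S` is reversible for `γ₁ ⊗ γ₂` (apply the `γ₁`-reversibility of `S₁` section by section).
* `blockMove_apply_univ` ∕ `blockMove_exists` (`(S₁ ∘ fst) ⊗ δ_{snd}` as a Mathlib kernel): Markov, and the hypothesis is not vacuous.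
* **`blockMoveProposal_invariant`**: for every flow bijection `e : Z₁ × Z₂ ≃ᵐ Ω`, weight `w > 0`: ANY kernel realising "pull back, move block 1 by
  `S₁`, push forward, accept with `min(1, w(y)/w(x))`, else stay" leaves `π = w·((γ₁ ⊗ γ₂).map e)` invariant (`latentProposal_invariant`).
  Block 2 likewise by the swap of factors; a sweep over blocks is exact by composition, a random block by `LatentMixtureProposals`; nesting
  `Z₁ × (Z₂ × ⋯)` gives any finite number of blocks.
-/

namespace Summit.Ventures.LatticeQCDFlow.Exactness

open MeasureTheory ProbabilityTheory
open scoped ENNReal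

variable {Z₁ Z₂ : Type*} [MeasurableSpace Z₁] [MeasurableSpace Z₂] {γ₁ : Measure Z₁} {γ₂ : Measure Z₂}
  [IsProbabilityMeasure γ₁] [IsProbabilityMeasure γ₂]

/-! ## §1 The block move is reversible for the product base -/

omit [IsProbabilityMeasure γ₁] in
/-- **THE MASS FLOW OF THE BLOCK MOVE, SECTION BY SECTION**:
`∫_A S(z, B) d(γ₁ ⊗ γ₂) = ∫ (∫_{A_{z₂}} S₁(z₁, B_{z₂}) γ₁(dz₁)) γ₂(dz₂)`. [ours] -/
theorem blockMove_setLIntegral [SFinite γ₁] (S₁ : Kernel Z₁ Z₁) (S : Kernel (Z₁ × Z₂) (Z₁ × Z₂))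
    (hS : ∀ (z : Z₁ × Z₂) {B : Set (Z₁ × Z₂)}, MeasurableSet B → S z B = S₁ z.1 ((fun z₁ => (z₁, z.2)) ⁻¹' B))
    {A B : Set (Z₁ × Z₂)} (hA : MeasurableSet A) (hB : MeasurableSet B) :
    ∫⁻ z in A, S z B ∂(γ₁.prod γ₂) =
      ∫⁻ z₂, ∫⁻ z₁ in (fun z₁ => (z₁, z₂)) ⁻¹' A, S₁ z₁ ((fun z₁ => (z₁, z₂)) ⁻¹' B) ∂γ₁ ∂γ₂ := by
  have hm : Measurable fun z : Z₁ × Z₂ => S z B := Kernel.measurable_coe S hB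
  rw [← lintegral_indicator hA, lintegral_prod_symm _ ((hm.indicator hA).aemeasurable)]
  refine lintegral_congr fun z₂ => ?_
  rw [← lintegral_indicator (measurable_prodMk_right hA)]
  refine lintegral_congr fun z₁ => ?_
  by_cases h : (z₁, z₂) ∈ A
  · rw [Set.indicator_of_mem h, Set.indicator_of_mem (show z₁ ∈ (fun x => (x, z₂)) ⁻¹' A from h), hS _ hB]
  · rw [Set.indicator_of_notMem h, Set.indicator_of_notMem (show z₁ ∉ (fun x => (x, z₂)) ⁻¹' A from h)]

omit [IsProbabilityMeasure γ₁] in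
/-- **THE BLOCK MOVE IS `γ₁ ⊗ γ₂`-REVERSIBLE** whenever `S₁` is `γ₁`-reversible. [ours] -/
theorem blockMove_isReversible [SFinite γ₁] (S₁ : Kernel Z₁ Z₁) (hS₁ : Kernel.IsReversible S₁ γ₁) (S : Kernel (Z₁ × Z₂) (Z₁ × Z₂))
    (hS : ∀ (z : Z₁ × Z₂) {B : Set (Z₁ × Z₂)}, MeasurableSet B → S z B = S₁ z.1 ((fun z₁ => (z₁, z.2)) ⁻¹' B)) :
    Kernel.IsReversible S (γ₁.prod γ₂) := by
  intro A B hA hB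
  rw [blockMove_setLIntegral S₁ S hS hA hB, blockMove_setLIntegral S₁ S hS hB hA]
  exact lintegral_congr fun z₂ => hS₁ (measurable_prodMk_right hA) (measurable_prodMk_right hB)

omit [IsProbabilityMeasure γ₁] [IsProbabilityMeasure γ₂] in
/-- `S(z, Z₁ × Z₂) = 1` when `S₁` is Markov. [ours, bookkeeping] -/
theorem blockMove_apply_univ (S₁ : Kernel Z₁ Z₁) [IsMarkovKernel S₁] (S : Kernel (Z₁ × Z₂) (Z₁ × Z₂))
    (hS : ∀ (z : Z₁ × Z₂) {B : Set (Z₁ × Z₂)}, MeasurableSet B → S z B = S₁ z.1 ((fun z₁ => (z₁, z.2)) ⁻¹' B)) (z : Z₁ × Z₂) :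
    S z Set.univ = 1 := by
  rw [hS z MeasurableSet.univ, Set.preimage_univ, measure_univ]

omit [IsProbabilityMeasure γ₁] [IsProbabilityMeasure γ₂] in
/-- The block move as a Mathlib kernel: `z ↦ S₁(z₁) ⊗ δ_{z₂}` — the hypothesis `hS` is not vacuous. [ours, remark] -/
theorem blockMove_exists (S₁ : Kernel Z₁ Z₁) [IsMarkovKernel S₁] :
    ∃ S : Kernel (Z₁ × Z₂) (Z₁ × Z₂), IsMarkovKernel S ∧
      ∀ (z : Z₁ × Z₂) {B : Set (Z₁ × Z₂)}, MeasurableSet B → S z B = S₁ z.1 ((fun z₁ => (z₁, z.2)) ⁻¹' B) := by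
  refine ⟨(S₁.comap Prod.fst measurable_fst) ×ₖ (Kernel.deterministic Prod.snd measurable_snd), inferInstance, fun z B hB => ?_⟩
  rw [Kernel.prod_apply, Kernel.comap_apply, Kernel.deterministic_apply, Measure.prod_dirac, Measure.map_apply measurable_prodMk_right hB]

/-! ## §2 Blockwise latent moves through the flow are exact -/

variable {Ω : Type*} [MeasurableSpace Ω] {w : Ω → ℝ}

/-- **BLOCKWISE LATENT MOVES THROUGH THE FLOW ARE EXACT**: product base `γ₁ ⊗ γ₂`, flow bijection `e`, weight `w > 0`; pull back, move block 1 by a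
`γ₁`-reversible Markov `S₁` keeping block 2, push forward, accept with `min(1, w(y)/w(x))`: `π = w·((γ₁ ⊗ γ₂).map e)` is invariant. [ours] -/
theorem blockMoveProposal_invariant (hw : Measurable w) (hw0 : ∀ x, 0 < w x) (e : Z₁ × Z₂ ≃ᵐ Ω) (S₁ : Kernel Z₁ Z₁) [IsMarkovKernel S₁]
    (hS₁ : Kernel.IsReversible S₁ γ₁) (S : Kernel (Z₁ × Z₂) (Z₁ × Z₂))
    (hS : ∀ (z : Z₁ × Z₂) {B : Set (Z₁ × Z₂)}, MeasurableSet B → S z B = S₁ z.1 ((fun z₁ => (z₁, z.2)) ⁻¹' B)) (R : Kernel Ω Ω)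
    (hR : ∀ (x : Ω) {B : Set Ω}, MeasurableSet B → R x B = S (e.symm x) (e ⁻¹' B)) (K : Kernel Ω Ω)
    (hK : ∀ (x : Ω) {B : Set Ω}, MeasurableSet B → K x B =
      ∫⁻ y in B, imhAcceptE w x y ∂(R x) + (1 - ∫⁻ y, imhAcceptE w x y ∂(R x)) * B.indicator 1 x) :
    Kernel.Invariant K (((γ₁.prod γ₂).map e).withDensity fun x => ENNReal.ofReal (w x)) := by
  haveI : IsMarkovKernel S := ⟨fun z => ⟨blockMove_apply_univ S₁ S hS z⟩⟩
  exact latentProposal_invariant hw hw0 e S (blockMove_isReversible S₁ hS₁ S hS) R hR K hK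

/-- … and the blockwise sampler is `π`-reversible. [ours] -/
theorem blockMoveProposal_isReversible (hw : Measurable w) (hw0 : ∀ x, 0 < w x) (e : Z₁ × Z₂ ≃ᵐ Ω) (S₁ : Kernel Z₁ Z₁) [IsMarkovKernel S₁]
    (hS₁ : Kernel.IsReversible S₁ γ₁) (S : Kernel (Z₁ × Z₂) (Z₁ × Z₂))
    (hS : ∀ (z : Z₁ × Z₂) {B : Set (Z₁ × Z₂)}, MeasurableSet B → S z B = S₁ z.1 ((fun z₁ => (z₁, z.2)) ⁻¹' B)) (R : Kernel Ω Ω)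
    (hR : ∀ (x : Ω) {B : Set Ω}, MeasurableSet B → R x B = S (e.symm x) (e ⁻¹' B)) (K : Kernel Ω Ω)
    (hK : ∀ (x : Ω) {B : Set Ω}, MeasurableSet B → K x B =
      ∫⁻ y in B, imhAcceptE w x y ∂(R x) + (1 - ∫⁻ y, imhAcceptE w x y ∂(R x)) * B.indicator 1 x) :
    Kernel.IsReversible K (((γ₁.prod γ₂).map e).withDensity fun x => ENNReal.ofReal (w x)) := by
  haveI : IsMarkovKernel S := ⟨fun z => ⟨blockMove_apply_univ S₁ S hS z⟩⟩
  exact latentProposal_isReversible hw hw0 e S (blockMove_isReversible S₁ hS₁ S hS) R hR K hK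

end Summit.Ventures.LatticeQCDFlow.Exactness
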